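import Summits.QuantumFields.YangMills.Theorems.LuscherReductionTwistedTraceScalingBOShellCoercive
import Summits.QuantumFields.YangMills.Theorems.LuscherReductionTwistedTraceScalingBOFibreBall
import Summits.QuantumFields.YangMills.Theorems.LuscherReductionTwistedTraceScalingBTTubeMagnetic
import Summits.QuantumFields.YangMills.Theorems.LuscherReductionTwistedTraceScalingBOCentralEventually
import HarnessLib

/-!
# THE FIBRE-MASS RATIO of the (B-OD) constant is `≤ 2` eventually — CONDITIONALLY on the discrete Poincaré lemma (H)
# (lane A of S-BASE, crux `TwistedTraceScaling` stmt-QuantumFields-20203, C4-CORE, the (OD) pen; `pub/ym-fleet/ym-luscher-20007-p1/COARSE-DESIGN.md` §30.4)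

On schedule B (`q = q_{β/2,β}`, gauge width `powScale 1 β`, profile radius `r_f = min(1/40, β^{-1/2}ℓ)`) the (B-OD) constant carries `√(M₂^γ/M₂^{γ,in})`,
`M₂^γ = ∫ 𝟙_{‖x‖≤r_f} f dπ`, `M₂^{γ,in} = ∫ 𝟙_{‖x‖≤r_f/12} f dπ`, `f(x) = e^{−q(x)}²·e^{−‖P_Γx‖²/(powScale 1 β)²}` (`x = linkEmbed v`, `v` balanced).  Under
(H) `ker(covCurl 1) ≤ constModes ⊔ gaugeModes`:
* `shell_integrand_le_of_hodge` — on the shell `‖x‖ > r_f/12` (balanced `x`, `β ≥ max(1, gap)`): `f(x) ≤ e^{−β·gap·(r_f/12)²}`, `gap = 2 − 2cos(2π/L)` (`…BOShellCoercive`);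
* ★★ `massRatio_le_two_of_hodge` — `∀ᶠ β, M₂^γ(β) ≤ 2·M₂^{γ,in}(β)`: the shell is `≤ π(univ)·e^{−gap·ℓ²/144}`, the inner mass is `≥ e^{−99}·π{‖x‖ < β^{-1}} ≥ e^{-99}(δ_β³/10)^{|E|}`,
  `δ_β = min(1/50, β^{-2}/(20|E|))` (`…BOFibreBall`), and `e^{−gap·ℓ²/144}` beats every power of `β`.
HONEST FRAMING: conditional on (H) (requested as an independent linear-algebra seat); (C5), the final `b`, (B-ST), C4-CORE OPEN; stub of a child of the CONDITIONAL route R2b1;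
not infinite volume, not a gap, not Clay.
-/

set_option autoImplicit false

noncomputable section

open MeasureTheory Filter Topology Real
open scoped BigOperators InnerProductSpace RealInnerProductSpace
open Literature.MathematicalPhysics.QuantumFieldTheory
open Literature.MathematicalPhysics.QuantumLattice

namespace Summit.QuantumFields.YangMills.Theorems.FemtoTransferGap.TwoLattice.ConstTube

open Summit.QuantumFields.YangMills.Theorems.FemtoTransferGap
open Summit.QuantumFields.YangMills.Theorems.FemtoTransferGap.TwoLattice
open Summit.QuantumFields.YangMills.Theorems.FemtoTransferGap.TwoLattice.Stiff
open Summit.QuantumFields.YangMills.Theorems.FemtoTransferGap.TwoLattice.Toron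
open Summit.QuantumFields.YangMills.Theorems.FemtoTransferGap.TwoLattice.Cov

variable {L : ℕ} [NeZero L]

/-! ## §1 The shell integrand under (H) -/

/-- **Shell integrand under (H)**: for balanced `v` with `R < ‖linkEmbed v‖`, `1 ≤ β`, `gap ≤ β` (`gap = 2 − 2cos(2π/L)`):
`e^{−q_{β/2,β}(x)}²·e^{−‖P_Γx‖²/(powScale 1 β)²} ≤ e^{−β·gap·R²}`. [cite: Luscher1983, §3] -/
theorem shell_integrand_le_of_hodge (hL : 2 ≤ L)
    (hH : LinearMap.ker (covCurl (1 : GaugeConfig 3 L SU2)) ≤ constModes L ⊔ gaugeModes L) {β : ℝ} (hβ : 1 ≤ β) (hβg : 2 - 2 * Real.cos (2 * Real.pi / L) ≤ β)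
    {v : Edge 3 L → Fin 3 → ℝ} (hv : v ∈ balancedSet L) {R : ℝ} (hR0 : 0 ≤ R) (hR : R < ‖linkEmbed L v‖) :
    Real.exp (-(stiffGaussExp L (β / 2) β (linkEmbed L v))) ^ 2 * Real.exp (-(‖(gaugeModes L).starProjection (linkEmbed L v)‖ ^ 2 / powScale 1 β ^ 2)) ≤
      Real.exp (-(β * (2 - 2 * Real.cos (2 * Real.pi / L)) * R ^ 2)) := by
  have hβ0 : 0 ≤ β := by linarith
  have hx : ∀ c ∈ constModes L, ⟪c, linkEmbed L v⟫ = 0 := fun c hc => inner_constMode_linkEmbed_eq_zero hc hv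
  have h := shell_gauss_le_of_hodge (L := L) hL hH (t := β / 2) (by linarith) (b := β) hβ0 (powScale 1 β) hx
  rw [mul_comm] at h
  refine h.trans (Real.exp_le_exp.2 ?_)
  -- `min(1/ps1², 2(β/2)gap) = min(β², β·gap) ≥ β·gap` and `‖x‖² ≥ R²`
  have hps : powScale 1 β = β⁻¹ := by rw [powScale_eq hβ, Real.rpow_neg_one]
  have hmin : β * (2 - 2 * Real.cos (2 * Real.pi / L)) ≤ min (1 / powScale 1 β ^ 2) (2 * (β / 2) * (2 - 2 * Real.cos (2 * Real.pi / L))) := by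
    refine le_min ?_ (le_of_eq (by ring))
    rw [hps, inv_pow, one_div, inv_inv]
    nlinarith [gap_pos (L := L) hL]
  have hgap0 : 0 ≤ β * (2 - 2 * Real.cos (2 * Real.pi / L)) := mul_nonneg hβ0 (gap_pos (L := L) hL).le
  have hx2 : R ^ 2 ≤ ‖linkEmbed L v‖ ^ 2 := pow_le_pow_left₀ hR0 hR.le 2
  have h1 : β * (2 - 2 * Real.cos (2 * Real.pi / L)) * R ^ 2 ≤ min (1 / powScale 1 β ^ 2) (2 * (β / 2) * (2 - 2 * Real.cos (2 * Real.pi / L))) * ‖linkEmbed L v‖ ^ 2 :=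
    mul_le_mul hmin hx2 (sq_nonneg _) (le_trans hgap0 hmin)
  linarith

/-! ## §2 ★★ The mass ratio under (H) -/

/-- ★★ **THE FIBRE-MASS RATIO IS `≤ 2` EVENTUALLY, UNDER (H)**: with `f(x) = e^{−q_{β/2,β}(x)}²e^{−‖P_Γx‖²/(powScale 1 β)²}` and `r_f = min(1/40, β^{-1/2}ℓ)`,
`∀ᶠ β, ∫ 𝟙_{‖x‖≤r_f} f dπ ≤ 2·∫ 𝟙_{‖x‖≤r_f/12} f dπ`. [cite: Luscher1983, §3] -/
theorem massRatio_le_two_of_hodge (hL : 2 ≤ L) (hH : LinearMap.ker (covCurl (1 : GaugeConfig 3 L SU2)) ≤ constModes L ⊔ gaugeModes L) :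
    ∀ᶠ β : ℝ in atTop,
      ∫ v, {v : Edge 3 L → Fin 3 → ℝ | ‖linkEmbed L v‖ ≤ min (1 / 40) (powScale (1 / 2) β * btLog β)}.indicator (fun _ => (1 : ℝ)) v *
          (Real.exp (-(stiffGaussExp L (β / 2) β (linkEmbed L v))) ^ 2 * Real.exp (-(‖(gaugeModes L).starProjection (linkEmbed L v)‖ ^ 2 / powScale 1 β ^ 2))) ∂orthoTransverse L ≤
        2 * ∫ v, {v : Edge 3 L → Fin 3 → ℝ | ‖linkEmbed L v‖ ≤ min (1 / 40) (powScale (1 / 2) β * btLog β) / 12}.indicator (fun _ => (1 : ℝ)) v *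
          (Real.exp (-(stiffGaussExp L (β / 2) β (linkEmbed L v))) ^ 2 * Real.exp (-(‖(gaugeModes L).starProjection (linkEmbed L v)‖ ^ 2 / powScale 1 β ^ 2))) ∂orthoTransverse L := by
  haveI := isFiniteMeasure_orthoTransverse L
  set gap : ℝ := 2 - 2 * Real.cos (2 * Real.pi / L) with hgap
  have hgp : 0 < gap := gap_pos (L := L) hL
  set E : ℕ := Fintype.card (Edge 3 L) with hEdef
  have hE : (0 : ℝ) < Fintype.card (Edge 3 L) := by exact_mod_cast Fintype.card_pos
  have hE1 : (1 : ℝ) ≤ Fintype.card (Edge 3 L) := by exact_mod_cast Fintype.card_pos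
  -- the floor constant `c(β) = e^{-99}·((β^{-2}/(20|E|))³/10)^{|E|}` and the shell bound `π(univ)·e^{−gap ℓ²/144}`: eventually shell ≤ floor
  set P : ℝ := (orthoTransverse L).real Set.univ with hPdef
  have hP0 : 0 ≤ P := measureReal_nonneg
  -- (1) `r_f = β^{-1/2}ℓ`, `β ≥ gap`, `β ≥ 1`, `β^{-1} ≤ r_f/12`, `β^{-2}/(20|E|) ≤ 1/50`
  have e1 : ∀ᶠ β : ℝ in atTop, min (1 / 40) (powScale (1 / 2) β * btLog β) = powScale (1 / 2) β * btLog β := by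
    filter_upwards [eventually_mul_le_of_tendsto tendsto_rf 1 (by norm_num : (0:ℝ) < 1 / 40)] with β h
    rw [one_mul] at h; exact min_eq_right h
  have e2 : ∀ᶠ β : ℝ in atTop, powScale 1 β ≤ powScale (1 / 2) β * btLog β / 12 := by
    -- `β^{-1} = β^{-1/2}·β^{-1/2} ≤ β^{-1/2}·ℓ/12` iff `12β^{-1/2} ≤ ℓ`
    have h := (tendsto_powScale (σ := 1 / 2) (by norm_num)).const_mul 12
    rw [mul_zero] at h
    filter_upwards [h.eventually (eventually_le_nhds one_pos), eventually_ge_atTop (1 : ℝ)] with β hβ hβ1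
    have hℓ := one_le_btLog β
    have hx := powScale_pos (1 / 2) β
    have hsplit : powScale 1 β = powScale (1 / 2) β * powScale (1 / 2) β := by rw [powScale_mul_powScale]; norm_num
    rw [hsplit]
    have : powScale (1 / 2) β * 12 ≤ btLog β := by linarith
    calc powScale (1 / 2) β * powScale (1 / 2) β = powScale (1 / 2) β * (powScale (1 / 2) β * 12) / 12 := by ring
      _ ≤ powScale (1 / 2) β * btLog β / 12 := by gcongr
  -- (2) the decisive comparison `P·e^{−gap ℓ²/144} ≤ e^{-99}·((β^{-2}/(20|E|))³/10)^{|E|}` eventually, via logarithms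
  have e3 : ∀ᶠ β : ℝ in atTop, P * Real.exp (-(gap * btLog β ^ 2 / 144)) ≤
      Real.exp (-99) * ((powScale 1 β ^ 2 / (20 * Fintype.card (Edge 3 L))) ^ 3 / 10) ^ Fintype.card (Edge 3 L) := by
    -- rewrite the floor as `exp(-99 - |E|·(6ℓ + log(10·(20|E|)³)))` for `β ≥ e` and compare exponents
    have hK : ∀ᶠ β : ℝ in atTop, Real.log (P + 1) + 99 + (Fintype.card (Edge 3 L) : ℝ) * (6 * btLog β + Real.log (10 * (20 * Fintype.card (Edge 3 L)) ^ 3)) ≤ gap * btLog β ^ 2 / 144 := by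
      -- `ℓ² ≫ ℓ`: divide by ℓ and use ℓ → ∞
      have h1 : Tendsto (fun β : ℝ => gap / 144 * btLog β - (Fintype.card (Edge 3 L) : ℝ) * 6) atTop atTop :=
        tendsto_atTop_add_const_right _ _ (tendsto_btLog_atTop.const_mul_atTop (by positivity))
      have h2 := h1.eventually_ge_atTop (Real.log (P + 1) + 99 + (Fintype.card (Edge 3 L) : ℝ) * Real.log (10 * (20 * Fintype.card (Edge 3 L)) ^ 3))
      filter_upwards [h2] with β hβ
      have hℓ := one_le_btLog β
      have hA : 0 ≤ Real.log (P + 1) + 99 + (Fintype.card (Edge 3 L) : ℝ) * Real.log (10 * (20 * Fintype.card (Edge 3 L)) ^ 3) := by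
        have : 0 ≤ Real.log (P + 1) := Real.log_nonneg (by linarith)
        have : 0 ≤ Real.log (10 * (20 * (Fintype.card (Edge 3 L) : ℝ)) ^ 3) := Real.log_nonneg (by nlinarith [pow_le_pow_left₀ (by norm_num : (0:ℝ) ≤ 20) (by nlinarith : (20:ℝ) ≤ 20 * (Fintype.card (Edge 3 L) : ℝ)) 3])
        positivity
      have hmul := mul_le_mul_of_nonneg_right hβ (le_trans zero_le_one hℓ)
      have hA1 : Real.log (P + 1) + 99 + (Fintype.card (Edge 3 L) : ℝ) * Real.log (10 * (20 * Fintype.card (Edge 3 L)) ^ 3) ≤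
          (Real.log (P + 1) + 99 + (Fintype.card (Edge 3 L) : ℝ) * Real.log (10 * (20 * Fintype.card (Edge 3 L)) ^ 3)) * btLog β := le_mul_of_one_le_right hA hℓ
      have e : (gap / 144 * btLog β - (Fintype.card (Edge 3 L) : ℝ) * 6) * btLog β = gap * btLog β ^ 2 / 144 - (Fintype.card (Edge 3 L) : ℝ) * (6 * btLog β) := by ring
      rw [e] at hmul
      nlinarith
    filter_upwards [hK, eventually_ge_atTop (1 : ℝ), eventually_btLog_eq] with β hβ hβ1 hℓeq
    have hβ0 : 0 < β := by linarith
    have hps : powScale 1 β = β⁻¹ := by rw [powScale_eq hβ1, Real.rpow_neg_one]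
    have hβexp : β = Real.exp (btLog β) := by rw [hℓeq, Real.exp_log hβ0]
    -- the floor as an exponential
    have hfloor : Real.exp (-99) * ((powScale 1 β ^ 2 / (20 * Fintype.card (Edge 3 L))) ^ 3 / 10) ^ Fintype.card (Edge 3 L) =
        Real.exp (-99 - (Fintype.card (Edge 3 L) : ℝ) * (6 * btLog β + Real.log (10 * (20 * Fintype.card (Edge 3 L)) ^ 3))) := by
      have hc : 0 < 10 * (20 * (Fintype.card (Edge 3 L) : ℝ)) ^ 3 := by positivity
      have e : (powScale 1 β ^ 2 / (20 * Fintype.card (Edge 3 L))) ^ 3 / 10 = Real.exp (-(6 * btLog β + Real.log (10 * (20 * Fintype.card (Edge 3 L)) ^ 3))) := by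
        rw [neg_add, Real.exp_add, Real.exp_neg (Real.log _), Real.exp_log hc, hps]
        rw [show -(6 * btLog β) = (6 : ℕ) * (-btLog β) by push_cast; ring, Real.exp_nat_mul, Real.exp_neg, ← hβexp]
        field_simp
      rw [e, ← Real.exp_nat_mul, ← Real.exp_add]
      congr 1; ring
    rw [hfloor]
    have hP1 : P ≤ Real.exp (Real.log (P + 1)) := by rw [Real.exp_log (by linarith)]; linarith
    calc P * Real.exp (-(gap * btLog β ^ 2 / 144)) ≤ Real.exp (Real.log (P + 1)) * Real.exp (-(gap * btLog β ^ 2 / 144)) :=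
          mul_le_mul_of_nonneg_right hP1 (Real.exp_pos _).le
      _ = Real.exp (Real.log (P + 1) - gap * btLog β ^ 2 / 144) := by rw [← Real.exp_add]; ring_nf
      _ ≤ _ := Real.exp_le_exp.2 (by linarith)
  have e4 : ∀ᶠ β : ℝ in atTop, powScale 1 β ^ 2 / (20 * Fintype.card (Edge 3 L)) ≤ 1 / 50 := by
    have h := ((tendsto_powScale (σ := 1) one_pos).pow 2).div_const (20 * (Fintype.card (Edge 3 L) : ℝ))
    rw [zero_pow two_ne_zero, zero_div] at h
    exact h.eventually (eventually_le_nhds (by norm_num))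
  filter_upwards [e1, e2, e3, e4, eventually_ge_atTop (max 1 gap)] with β hrf hin hcmp hδ50 hβm
  have hβ1 : 1 ≤ β := le_trans (le_max_left _ _) hβm
  have hβg : gap ≤ β := le_trans (le_max_right _ _) hβm
  have hβ0 : 0 < β := by linarith
  set f : (Edge 3 L → Fin 3 → ℝ) → ℝ := fun v => Real.exp (-(stiffGaussExp L (β / 2) β (linkEmbed L v))) ^ 2 *
    Real.exp (-(‖(gaugeModes L).starProjection (linkEmbed L v)‖ ^ 2 / powScale 1 β ^ 2)) with hfdef
  have hf0 : ∀ v, 0 ≤ f v := fun v => by rw [hfdef]; positivity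
  have hf1 : ∀ v, f v ≤ 1 := fun v => by
    rw [hfdef]; dsimp only
    have h1 : Real.exp (-(stiffGaussExp L (β / 2) β (linkEmbed L v))) ^ 2 ≤ 1 :=
      pow_le_one₀ (Real.exp_pos _).le (Real.exp_le_one_iff.mpr (neg_nonpos.mpr (stiffGaussExp_nonneg _ _ _)))
    have h2 : Real.exp (-(‖(gaugeModes L).starProjection (linkEmbed L v)‖ ^ 2 / powScale 1 β ^ 2)) ≤ 1 := Real.exp_le_one_iff.mpr (neg_nonpos.mpr (by positivity))
    calc _ ≤ 1 * 1 := mul_le_mul h1 h2 (Real.exp_pos _).le zero_le_one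
      _ = 1 := one_mul _
  have hfm : Measurable f := by
    rw [hfdef]
    exact ((((measurable_stiffGaussExp (β / 2) β).comp (measurable_linkEmbed L)).neg.exp).pow_const 2).mul
      ((((gaugeModes L).starProjection.continuous.measurable.comp (measurable_linkEmbed L)).norm.pow_const 2).div_const _).neg.exp
  set Sall := {v : Edge 3 L → Fin 3 → ℝ | ‖linkEmbed L v‖ ≤ (min (1 / 40) (powScale (1 / 2) β * btLog β))} with hSall
  set Sin := {v : Edge 3 L → Fin 3 → ℝ | ‖linkEmbed L v‖ ≤ (min (1 / 40) (powScale (1 / 2) β * btLog β)) / 12} with hSin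
  have hmSall : MeasurableSet Sall := measurableSet_le (measurable_linkEmbed L).norm measurable_const
  have hmSin : MeasurableSet Sin := measurableSet_le (measurable_linkEmbed L).norm measurable_const
  -- integrability
  have hI : ∀ S : Set (Edge 3 L → Fin 3 → ℝ), MeasurableSet S → Integrable (fun v => S.indicator (fun _ => (1 : ℝ)) v * f v) (orthoTransverse L) := fun S hS =>
    integrable_of_measurable_abs_le _ ((measurable_const.indicator hS).mul hfm) (C := 1) fun v => by
      rw [abs_mul, abs_of_nonneg (hf0 v)]
      by_cases h : v ∈ S
      · rw [Set.indicator_of_mem h, abs_one, one_mul]; exact hf1 v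
      · rw [Set.indicator_of_notMem h, abs_zero, zero_mul]; exact zero_le_one
  -- (a) whole ball ≤ inner + shell, shell ≤ P·e^{−β gap ((min (1 / 40) (powScale (1 / 2) β * btLog β))/12)²} pointwise-a.e. (balanced `v`)
  have hae : ∀ᵐ v ∂orthoTransverse L, v ∈ capBalancedSet L := by rw [ae_iff]; exact orthoTransverse_compl_capBalancedSet L
  have hshell_pt : ∀ᵐ v ∂orthoTransverse L, Sall.indicator (fun _ => (1 : ℝ)) v * f v ≤ Sin.indicator (fun _ => (1 : ℝ)) v * f v + Real.exp (-(β * gap * ((min (1 / 40) (powScale (1 / 2) β * btLog β)) / 12) ^ 2)) := by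
    filter_upwards [hae] with v hv
    by_cases hin' : v ∈ Sin
    · rw [Set.indicator_of_mem hin', one_mul]
      have : Sall.indicator (fun _ => (1 : ℝ)) v * f v ≤ f v := by
        by_cases h : v ∈ Sall
        · rw [Set.indicator_of_mem h, one_mul]
        · rw [Set.indicator_of_notMem h, zero_mul]; exact hf0 v
      linarith [Real.exp_pos (-(β * gap * ((min (1 / 40) (powScale (1 / 2) β * btLog β)) / 12) ^ 2))]
    · rw [Set.indicator_of_notMem hin', zero_mul, zero_add]
      have hR : (min (1 / 40) (powScale (1 / 2) β * btLog β)) / 12 < ‖linkEmbed L v‖ := lt_of_not_ge hin'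
      have hrf0 : 0 ≤ (min (1 / 40) (powScale (1 / 2) β * btLog β)) / 12 := by
        have : 0 ≤ (min (1 / 40) (powScale (1 / 2) β * btLog β)) := le_min (by norm_num) (mul_nonneg (powScale_pos _ _).le (le_trans zero_le_one (one_le_btLog β)))
        linarith
      have hsh := shell_integrand_le_of_hodge (L := L) hL hH hβ1 hβg hv.1 hrf0 hR
      calc Sall.indicator (fun _ => (1 : ℝ)) v * f v ≤ f v := by
            by_cases h : v ∈ Sall
            · rw [Set.indicator_of_mem h, one_mul]
            · rw [Set.indicator_of_notMem h, zero_mul]; exact hf0 v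
        _ ≤ Real.exp (-(β * gap * ((min (1 / 40) (powScale (1 / 2) β * btLog β)) / 12) ^ 2)) := hsh
  have hstep1 : ∫ v, Sall.indicator (fun _ => (1 : ℝ)) v * f v ∂orthoTransverse L ≤ ∫ v, Sin.indicator (fun _ => (1 : ℝ)) v * f v ∂orthoTransverse L + P * Real.exp (-(β * gap * ((min (1 / 40) (powScale (1 / 2) β * btLog β)) / 12) ^ 2)) := by
    calc ∫ v, Sall.indicator (fun _ => (1 : ℝ)) v * f v ∂orthoTransverse L
        ≤ ∫ v, (Sin.indicator (fun _ => (1 : ℝ)) v * f v + Real.exp (-(β * gap * ((min (1 / 40) (powScale (1 / 2) β * btLog β)) / 12) ^ 2))) ∂orthoTransverse L :=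
          integral_mono_ae (hI Sall hmSall) ((hI Sin hmSin).add (integrable_const _)) hshell_pt
      _ = ∫ v, Sin.indicator (fun _ => (1 : ℝ)) v * f v ∂orthoTransverse L + P * Real.exp (-(β * gap * ((min (1 / 40) (powScale (1 / 2) β * btLog β)) / 12) ^ 2)) := by
          rw [integral_add (hI Sin hmSin) (integrable_const _), integral_const, smul_eq_mul, hPdef, mul_comm]
  -- (b) the shell is below the inner floor
  have hβrf : β * gap * ((min (1 / 40) (powScale (1 / 2) β * btLog β)) / 12) ^ 2 = gap * btLog β ^ 2 / 144 := by
    rw [hrf]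
    have h2 : β * powScale (1 / 2) β ^ 2 = 1 := mul_powScale_half_sq hβ1
    calc β * gap * (powScale (1 / 2) β * btLog β / 12) ^ 2 = gap * (β * powScale (1 / 2) β ^ 2) * btLog β ^ 2 / 144 := by ring
      _ = gap * btLog β ^ 2 / 144 := by rw [h2, mul_one]
  have hinner : Real.exp (-99) * ((powScale 1 β ^ 2 / (20 * Fintype.card (Edge 3 L))) ^ 3 / 10) ^ Fintype.card (Edge 3 L) ≤ ∫ v, Sin.indicator (fun _ => (1 : ℝ)) v * f v ∂orthoTransverse L := by
    -- `inner_gauss_mass_ge` with `ρ = β^{-1} ≤ (min (1 / 40) (powScale (1 / 2) β * btLog β))/12`, `t = β/2`, `b = β`, `s = β^{-1}`: exponent `(2(96·β/2+β)+β²)·β^{-2} ≤ 99`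
    have hρ : powScale 1 β ≤ (min (1 / 40) (powScale (1 / 2) β * btLog β)) / 12 := by rw [hrf]; exact hin
    have h := inner_gauss_mass_ge (L := L) (t := β / 2) (b := β) (s := powScale 1 β) (ρ := powScale 1 β) (R := (min (1 / 40) (powScale (1 / 2) β * btLog β)) / 12) (by linarith) hβ0.le (powScale_pos 1 β) hρ
    have hexp : Real.exp (-99) ≤ Real.exp (-((2 * (96 * (β / 2) + β) + 1 / powScale 1 β ^ 2) * powScale 1 β ^ 2)) := by
      apply Real.exp_le_exp.2
      have hps : powScale 1 β = β⁻¹ := by rw [powScale_eq hβ1, Real.rpow_neg_one]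
      rw [hps]
      have hβi : β⁻¹ ≤ 1 := inv_le_one_of_one_le₀ hβ1
      have hβi0 : 0 < β⁻¹ := inv_pos.2 hβ0
      have e : (2 * (96 * (β / 2) + β) + 1 / β⁻¹ ^ 2) * β⁻¹ ^ 2 = 98 * β⁻¹ + 1 := by field_simp; ring
      rw [e]; linarith
    have hball := orthoTransverse_real_ball_ge (L := L) (ρ := powScale 1 β) (powScale_pos 1 β)
    have hδeq : min (1 / 50) (powScale 1 β ^ 2 / (20 * Fintype.card (Edge 3 L))) = powScale 1 β ^ 2 / (20 * Fintype.card (Edge 3 L)) := min_eq_right hδ50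
    rw [hδeq] at hball
    calc Real.exp (-99) * ((powScale 1 β ^ 2 / (20 * Fintype.card (Edge 3 L))) ^ 3 / 10) ^ Fintype.card (Edge 3 L)
        ≤ Real.exp (-((2 * (96 * (β / 2) + β) + 1 / powScale 1 β ^ 2) * powScale 1 β ^ 2)) * (orthoTransverse L).real {v | ‖linkEmbed L v‖ < powScale 1 β} :=
          mul_le_mul hexp hball (by positivity) (Real.exp_pos _).le
      _ ≤ _ := h
  have hshell_le : P * Real.exp (-(β * gap * ((min (1 / 40) (powScale (1 / 2) β * btLog β)) / 12) ^ 2)) ≤ ∫ v, Sin.indicator (fun _ => (1 : ℝ)) v * f v ∂orthoTransverse L := by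
    rw [hβrf]; exact hcmp.trans hinner
  linarith

end Summit.QuantumFields.YangMills.Theorems.FemtoTransferGap.TwoLattice.ConstTube

end
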